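import Summits.CriticalPhenomena.PercolationContinuityZ3.Theorems.Transplant.FKConnectivityAllQForestNearTightEarsMain
import HarnessLib

/-!
# Fans of every length and THE LOCALLY-CONNECTED THEOREM for the square-free adjacent forest Rayleigh node

Support file (`--supports stmt-CriticalPhenomena-4575`), FK sub-lane `prim-bschramm-fk-1` (gen 22) of the post-continuity programme;
builds on p205010 (kernel theorem, internal audit signed; external expert review pending).  No definitions, no named facts, no sorries;
standard axioms.

THE NODE (`AdjForestRayleighNoSqOn`): `#(Fo ∩ {e, f ∈ ω}, Fo) ≤ #(Fo ∩ {e ∈ ω}, Fo ∩ {f ∈ ω})` on a fibre `(M, u₀)`: the pairs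
`e = ov`, `f = oy` are negatively correlated in the uniform ordered two-forest partition of a finite multigraph (open in general;
it implies the adjacent case of the Grimmett–Winkler / Semple–Welsh negative-correlation conjecture for uniform forests).
THIS FILE specialises THE EARS THEOREM (`adjForestNoSq_fibre_of_ears`) to fans and proves the lineage's LOCALLY-CONNECTED THEOREM
(memo bschramm/FROM-fk-1-g21-SIGMA-EXCHANGE.md §3c; gen 21 had ℓ = 1, 2 in the kernel):
* **`adjForestNoSq_fibre_of_fan_mem`** — the FAN OF LENGTH `ℓ ≥ 2`: distinct neighbours `x₀ = v, x₁, …, x_ℓ = y` of `o` with all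
  spokes `o x_i` and rims `x_{i−1} x_i` free (in `M`) ⇒ the node's inequality at `(o; v, y)` on `(M, u₀)` (gadget `U = {o, x₀, …, x_ℓ}`,
  `|E| = 2ℓ + 1 = 2|U| − 3`, ears `x₀` and `x_ℓ`);
* **`adjForestNoSq_fibre_of_fan`** — all `ℓ ≥ 1` (`ℓ = 1` is the triangle theorem);
* **`adjForestNoSq_fibre_of_linkReachable`** — THE LOCALLY-CONNECTED THEOREM: if `v ≠ y` are joined by a path of free pairs all of
  whose vertices are free neighbours of `o` (i.e. `v ~ y` in the link of `o` of the graph of free pairs), the node's inequality holds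
  at `(o; v, y)` on `(M, u₀)` — a shortest such path is a fan;
* **`adjForestNoSq_top_of_linkReachable`** — top fibres: for every finite simple graph, vertex `o` and neighbours `v ≠ y` of `o`
  lying in one component of `G[N(o)]`, `#{(A, B) : ov, oy ∈ A} ≤ #{(A, B) : ov ∈ A, oy ∈ B}` over ordered two-forest partitions —
  so the node holds at every apex vertex with `G − o` connected, at the hub of every wheel, at every vertex of a 2-tree, at every
  locally connected vertex.
Not in print as searched (seat notes); Semple–Welsh prove coefficientwise Rayleigh for all pairs exactly for graphs with no `K₄` minor.
[cite: SempleWelsh2008, Conj. 1.1 (p. 2); Thm. 4.2 (p. 11)] [cite: Linusson2011, Prop. 2.6] [cite: Grimmett2006, §1.5 (p. 13)]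
-/

noncomputable section

namespace Summit.CriticalPhenomena.PercolationContinuityZ3.Theorems
namespace FK

open Set Literature.Probability.LatticeModels Literature.Probability.Percolation
open scoped Classical symmDiff

variable {V : Type*} [Fintype V]

section Fan

variable {M u₀ : BondConfig V} {o : V}

/-- **THE FAN THEOREM (`ℓ ≥ 2`, all fan pairs free)**: for distinct vertices `x 0, …, x ℓ ≠ o` with `s(o, x i) ∈ M` (`i ≤ ℓ`) and
`s(x i, x (i+1)) ∈ M` (`i < ℓ`): `#(Fo ∩ {o x₀, o x_ℓ ∈ ω}, Fo) ≤ #(Fo ∩ {o x₀ ∈ ω}, Fo ∩ {o x_ℓ ∈ ω})` on `(M, u₀)`.  The ears theorem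
for the gadget `U = {o, x 0, …, x ℓ}`, `E` = spokes ∪ rims (`|U| = ℓ + 2`, `|E| = 2ℓ + 1`).
[cite: SempleWelsh2008, Conj. 1.1 (p. 2)] [cite: Linusson2011, Prop. 2.6] [cite: Grimmett2006, §1.5 (p. 13)] -/
theorem adjForestNoSq_fibre_of_fan_mem {x : ℕ → V} {ℓ : ℕ} (hℓ : 2 ≤ ℓ)
    (hinj : ∀ i j, i ≤ ℓ → j ≤ ℓ → x i = x j → i = j) (hxo : ∀ i ≤ ℓ, x i ≠ o) (hsp : ∀ i ≤ ℓ, s(o, x i) ∈ M)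
    (hrim : ∀ i < ℓ, s(x i, x (i + 1)) ∈ M) :
    fibreCount M u₀ (forestEv V ∩ {ω | s(o, x 0) ∈ ω ∧ s(o, x ℓ) ∈ ω}) (forestEv V) ≤
      fibreCount M u₀ (forestEv V ∩ {ω | s(o, x 0) ∈ ω}) (forestEv V ∩ {ω | s(o, x ℓ) ∈ ω}) := by
  -- the gadget
  set U : Finset V := insert o ((Finset.range (ℓ + 1)).image x) with hU
  set E : Finset (Sym2 V) := (Finset.range (ℓ + 1)).image (fun i => s(o, x i)) ∪
    (Finset.range ℓ).image (fun i => s(x i, x (i + 1))) with hE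
  have hEM : ∀ g ∈ E, g ∈ M := by
    intro g hg
    rcases Finset.mem_union.1 hg with hg | hg
    · obtain ⟨i, hi, rfl⟩ := Finset.mem_image.1 hg
      exact hsp i (by have := Finset.mem_range.1 hi; omega)
    · obtain ⟨i, hi, rfl⟩ := Finset.mem_image.1 hg
      exact hrim i (Finset.mem_range.1 hi)
  have hoU : o ∈ U := Finset.mem_insert_self _ _
  have hxU : ∀ i ≤ ℓ, x i ∈ U := fun i hi =>
    Finset.mem_insert_of_mem (Finset.mem_image_of_mem x (Finset.mem_range.2 (by omega)))
  have hEU : ∀ g ∈ E, ∀ w ∈ g, w ∈ U := by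
    intro g hg w hw
    rcases Finset.mem_union.1 hg with hg | hg
    · obtain ⟨i, hi, rfl⟩ := Finset.mem_image.1 hg
      have hi' := Finset.mem_range.1 hi
      rcases Sym2.mem_iff.1 hw with rfl | rfl
      · exact hoU
      · exact hxU i (by omega)
    · obtain ⟨i, hi, rfl⟩ := Finset.mem_image.1 hg
      have hi' := Finset.mem_range.1 hi
      rcases Sym2.mem_iff.1 hw with rfl | rfl
      · exact hxU i (by omega)
      · exact hxU (i + 1) (by omega)
  -- counting: `|U| = ℓ + 2`, `|E| = 2ℓ + 1`
  have hinj1 : Set.InjOn x ↑(Finset.range (ℓ + 1)) := fun i hi j hj h => by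
    have hi' := Finset.mem_range.1 (Finset.mem_coe.1 hi)
    have hj' := Finset.mem_range.1 (Finset.mem_coe.1 hj)
    exact hinj i j (by omega) (by omega) h
  have hUcard : U.card = ℓ + 2 := by
    rw [hU, Finset.card_insert_of_notMem, Finset.card_image_of_injOn hinj1, Finset.card_range]
    intro ho
    obtain ⟨i, hi, hix⟩ := Finset.mem_image.1 ho
    exact hxo i (by have := Finset.mem_range.1 hi; omega) hix
  have hinj2 : Set.InjOn (fun i => s(o, x i)) ↑(Finset.range (ℓ + 1)) := fun i hi j hj h => by
    have hi' := Finset.mem_range.1 (Finset.mem_coe.1 hi)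
    have hj' := Finset.mem_range.1 (Finset.mem_coe.1 hj)
    exact hinj i j (by omega) (by omega) (Sym2.congr_right.1 h)
  have hinj3 : Set.InjOn (fun i => s(x i, x (i + 1))) ↑(Finset.range ℓ) := fun i hi j hj h => by
    have hi' := Finset.mem_range.1 (Finset.mem_coe.1 hi)
    have hj' := Finset.mem_range.1 (Finset.mem_coe.1 hj)
    rcases Sym2.eq_iff.1 h with ⟨h1, _⟩ | ⟨h1, h2⟩
    · exact hinj i j (by omega) (by omega) h1
    · have h3 := hinj i (j + 1) (by omega) (by omega) h1
      have h4 := hinj (i + 1) j (by omega) (by omega) h2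
      omega
  have hdisjE : Disjoint ((Finset.range (ℓ + 1)).image (fun i => s(o, x i)))
      ((Finset.range ℓ).image (fun i => s(x i, x (i + 1)))) := by
    rw [Finset.disjoint_left]
    intro g hg hg'
    obtain ⟨i, -, rfl⟩ := Finset.mem_image.1 hg
    obtain ⟨j, hj, hji⟩ := Finset.mem_image.1 hg'
    have hj' := Finset.mem_range.1 hj
    have ho : o ∈ s(x j, x (j + 1)) := by rw [hji]; exact Sym2.mem_mk_left _ _
    rcases Sym2.mem_iff.1 ho with h | h
    · exact hxo j (by omega) h.symm
    · exact hxo (j + 1) (by omega) h.symm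
  have hEcard : E.card = 2 * ℓ + 1 := by
    rw [hE, Finset.card_union_of_disjoint hdisjE, Finset.card_image_of_injOn hinj2, Finset.card_image_of_injOn hinj3,
      Finset.card_range, Finset.card_range]
    omega
  have hcard : 2 * U.card ≤ E.card + 3 := by rw [hUcard, hEcard]; omega
  -- memberships
  have hspE : ∀ i ≤ ℓ, s(o, x i) ∈ E := fun i hi =>
    Finset.mem_union_left _ (Finset.mem_image.2 ⟨i, Finset.mem_range.2 (by omega), rfl⟩)
  have hrimE : ∀ i < ℓ, s(x i, x (i + 1)) ∈ E := fun i hi =>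
    Finset.mem_union_right _ (Finset.mem_image.2 ⟨i, Finset.mem_range.2 hi, rfl⟩)
  have hrE : s(x 0, x 1) ∈ E := hrimE 0 (by omega)
  have htE : s(x (ℓ - 1), x ℓ) ∈ E := by
    have h := hrimE (ℓ - 1) (by omega)
    rwa [show ℓ - 1 + 1 = ℓ by omega] at h
  -- the ears
  have hve : ∀ g ∈ E, x 0 ∈ g → g = s(o, x 0) ∨ g = s(x 0, x 1) := by
    intro g hg h0
    rcases Finset.mem_union.1 hg with hg | hg
    · obtain ⟨i, hi, rfl⟩ := Finset.mem_image.1 hg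
      have hi' := Finset.mem_range.1 hi
      rcases Sym2.mem_iff.1 h0 with h | h
      · exact absurd h (hxo 0 (by omega))
      · have := hinj 0 i (by omega) (by omega) h
        subst this
        exact Or.inl rfl
    · obtain ⟨i, hi, rfl⟩ := Finset.mem_image.1 hg
      have hi' := Finset.mem_range.1 hi
      rcases Sym2.mem_iff.1 h0 with h | h
      · have := hinj 0 i (by omega) (by omega) h
        subst this
        exact Or.inr rfl
      · have := hinj 0 (i + 1) (by omega) (by omega) h
        omega
  have hye : ∀ g ∈ E, x ℓ ∈ g → g = s(o, x ℓ) ∨ g = s(x (ℓ - 1), x ℓ) := by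
    intro g hg h0
    rcases Finset.mem_union.1 hg with hg | hg
    · obtain ⟨i, hi, rfl⟩ := Finset.mem_image.1 hg
      have hi' := Finset.mem_range.1 hi
      rcases Sym2.mem_iff.1 h0 with h | h
      · exact absurd h (hxo ℓ le_rfl)
      · have := hinj ℓ i le_rfl (by omega) h
        subst this
        exact Or.inl rfl
    · obtain ⟨i, hi, rfl⟩ := Finset.mem_image.1 hg
      have hi' := Finset.mem_range.1 hi
      rcases Sym2.mem_iff.1 h0 with h | h
      · have := hinj ℓ i le_rfl (by omega) h
        omega
      · have := hinj ℓ (i + 1) le_rfl (by omega) h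
        refine Or.inr ?_
        rw [show ℓ - 1 = i by omega, ← this]
  -- distinctness
  have hov : o ≠ x 0 := (hxo 0 (by omega)).symm
  have hoy : o ≠ x ℓ := (hxo ℓ le_rfl).symm
  have hvy : x 0 ≠ x ℓ := fun h => by have := hinj 0 ℓ (by omega) le_rfl h; omega
  have hvv' : x 0 ≠ x 1 := fun h => by have := hinj 0 1 (by omega) (by omega) h; omega
  have hyy' : x ℓ ≠ x (ℓ - 1) := fun h => by have := hinj ℓ (ℓ - 1) le_rfl (by omega) h; omega
  have hv'y : x 1 ≠ x ℓ := fun h => by have := hinj 1 ℓ (by omega) le_rfl h; omega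
  have hvy' : x 0 ≠ x (ℓ - 1) := fun h => by have := hinj 0 (ℓ - 1) (by omega) (by omega) h; omega
  exact adjForestNoSq_fibre_of_ears hEM hEU hcard (hspE 0 (by omega)) (hspE ℓ le_rfl) hrE htE hve hye hov hoy hvy hvv' hyy'
    hv'y hvy'

/-- **THE FAN THEOREM, all lengths `ℓ ≥ 1`** (all fan pairs free): `ℓ = 1` is the triangle theorem
`adjForestNoSq_fibre_of_triangle_mem`, `ℓ ≥ 2` is `adjForestNoSq_fibre_of_fan_mem`.
[cite: SempleWelsh2008, Conj. 1.1 (p. 2)] [cite: Linusson2011, Prop. 2.6] [cite: Grimmett2006, §1.5 (p. 13)] -/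
theorem adjForestNoSq_fibre_of_fan {x : ℕ → V} {ℓ : ℕ} (hℓ : 1 ≤ ℓ)
    (hinj : ∀ i j, i ≤ ℓ → j ≤ ℓ → x i = x j → i = j) (hxo : ∀ i ≤ ℓ, x i ≠ o) (hsp : ∀ i ≤ ℓ, s(o, x i) ∈ M)
    (hrim : ∀ i < ℓ, s(x i, x (i + 1)) ∈ M) :
    fibreCount M u₀ (forestEv V ∩ {ω | s(o, x 0) ∈ ω ∧ s(o, x ℓ) ∈ ω}) (forestEv V) ≤
      fibreCount M u₀ (forestEv V ∩ {ω | s(o, x 0) ∈ ω}) (forestEv V ∩ {ω | s(o, x ℓ) ∈ ω}) := by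
  rcases Nat.lt_or_ge ℓ 2 with h | h
  · have hℓ1 : ℓ = 1 := by omega
    subst hℓ1
    have hvy : x 0 ≠ x 1 := fun h' => by have := hinj 0 1 (by omega) le_rfl h'; omega
    exact adjForestNoSq_fibre_of_triangle_mem (hxo 0 (by omega)).symm (hxo 1 le_rfl).symm hvy (hsp 0 (by omega))
      (hsp 1 le_rfl) (hrim 0 (by omega))
  · exact adjForestNoSq_fibre_of_fan_mem h hinj hxo hsp hrim

/-- **THE LOCALLY-CONNECTED THEOREM** (fibre form, free link): if `v ≠ y` are joined by a path of free pairs all of whose vertices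
`w` are free neighbours of `o` (`w ≠ o`, `s(o, w) ∈ M`) — i.e. `v ~ y` in the LINK of `o` in the graph of free pairs — then
`#(Fo ∩ {ov, oy ∈ ω}, Fo) ≤ #(Fo ∩ {ov ∈ ω}, Fo ∩ {oy ∈ ω})` on `(M, u₀)`.  A shortest such path is a fan with free pairs.
[cite: SempleWelsh2008, Conj. 1.1 (p. 2)] [cite: Linusson2011, Prop. 2.6] [cite: Grimmett2006, §1.5 (p. 13)] -/
theorem adjForestNoSq_fibre_of_linkReachable {v y : V} (hvy : v ≠ y)
    (h : (openGraph {g ∈ M | ∀ w ∈ g, w ≠ o ∧ s(o, w) ∈ M}).Reachable v y) :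
    fibreCount M u₀ (forestEv V ∩ {ω | s(o, v) ∈ ω ∧ s(o, y) ∈ ω}) (forestEv V) ≤
      fibreCount M u₀ (forestEv V ∩ {ω | s(o, v) ∈ ω}) (forestEv V ∩ {ω | s(o, y) ∈ ω}) := by
  obtain ⟨p, hp⟩ := h.exists_isPath
  have hℓ : 1 ≤ p.length := by
    by_contra h0
    have h0' : p.length = 0 := by omega
    exact hvy (SimpleGraph.Walk.eq_of_length_eq_zero h0')
  -- the path edges
  have hedge : ∀ i < p.length, s(p.getVert i, p.getVert (i + 1)) ∈ M ∧
      (p.getVert i ≠ o ∧ s(o, p.getVert i) ∈ M) ∧ (p.getVert (i + 1) ≠ o ∧ s(o, p.getVert (i + 1)) ∈ M) := by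
    intro i hi
    have ha := p.adj_getVert_succ hi
    rw [openGraph_adj] at ha
    obtain ⟨⟨hgM, hgw⟩, -⟩ := ha
    exact ⟨hgM, hgw _ (Sym2.mem_mk_left _ _), hgw _ (Sym2.mem_mk_right _ _)⟩
  have hvert : ∀ i ≤ p.length, p.getVert i ≠ o ∧ s(o, p.getVert i) ∈ M := by
    intro i hi
    rcases Nat.lt_or_ge i p.length with hi' | hi'
    · exact (hedge i hi').2.1
    · have : i = p.length - 1 + 1 := by omega
      rw [this]
      exact (hedge (p.length - 1) (by omega)).2.2
  have key := adjForestNoSq_fibre_of_fan (M := M) (u₀ := u₀) (o := o) (x := p.getVert) hℓ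
    (fun i j hi hj hij => hp.getVert_injOn (by exact hi) (by exact hj) hij) (fun i hi => (hvert i hi).1)
    (fun i hi => (hvert i hi).2) (fun i hi => (hedge i hi).1)
  rwa [SimpleGraph.Walk.getVert_zero, SimpleGraph.Walk.getVert_length] at key

/-- **THE LOCALLY-CONNECTED THEOREM, top fibres** (simple graphs; vertex form): for a finite simple graph with pair set `Eg`, a vertex
`o` and two vertices `v ≠ y` lying in one component of the link `G[N(o)]` (joined by a path of `Eg`-pairs through neighbours of `o`
only), the number of ordered partitions `(A, Eg ∖ A)` of `Eg` into two forests with `ov, oy ∈ A` is at most the number with `ov ∈ A`,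
`oy ∉ A`: the spokes `ov, oy` are negatively correlated.  Covers every apex vertex with `G − o` connected between `v` and `y`, the hub
of every wheel, every vertex of a 2-tree. [cite: SempleWelsh2008, Conj. 1.1 (p. 2)] [cite: Linusson2011, Prop. 2.6] -/
theorem adjForestNoSq_top_of_linkReachable (Eg : BondConfig V) {v y : V} (hvy : v ≠ y)
    (h : (openGraph {g ∈ Eg | ∀ w ∈ g, w ≠ o ∧ s(o, w) ∈ Eg}).Reachable v y) :
    fibreCount Eg ∅ (forestEv V ∩ {ω | s(o, v) ∈ ω ∧ s(o, y) ∈ ω}) (forestEv V) ≤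
      fibreCount Eg ∅ (forestEv V ∩ {ω | s(o, v) ∈ ω}) (forestEv V ∩ {ω | s(o, y) ∈ ω}) :=
  adjForestNoSq_fibre_of_linkReachable hvy h

end Fan

end FK
end Summit.CriticalPhenomena.PercolationContinuityZ3.Theorems

end
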